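import Literature.MathematicalPhysics.QuantumFieldTheory.CubicalCochainsBox
import HarnessLib

/-!
# Cubical cochains on `ℤ^d`: the Poincaré lemma in degree two on a box (plaquette fields which
# are closed on the cubes of a box are coboundaries of comb-gauge link fields)

Companion of `CubicalCochains.lean` / `CubicalCochainsBox.lean` (namespace
`…QuantumFieldTheory.LatticeForm`), and support file for the duality transformation of the
four-dimensional `U(1)` theory with Villain action (proof programme of the named fact
`Literature.MathematicalPhysics.QuantumFieldTheory.FrohlichSpencerU1PerimeterLawD4` and of its
corollary `Literature.Barriers.QuantumFields.AbelianDeconfinementD4`). In the Villain model on a box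
`Λ = [a, b]` every plaquette `p ⊂ Λ` carries an integer `n_p`; grouping the integer plaquette
fields `n` by their flux `q = dn` through the CUBES of `Λ` (the monopole density, FS82 §2.4
(2.21)–(2.22) in the dual language), the fibre over `q` consists of `n + dℓ`, `ℓ` an integer link
field of `Λ`, and summing over it unfolds the compact link angles to real variables
(`PeriodicUnfolding`). The homological input is the RELATIVE Poincaré lemma proved here:

* `boxPrim₂ ω a k` — the recursive primitive: integrate the axes `0, …, k-1` in turn, in the
  axial gauge along the axis being integrated (`θ(x; κ) = 0`), correcting the lower axes by the
  column sums `-∑_{a_κ ≤ t < x_κ} ω((x, x_κ := t); i, κ)`;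
* `exists_d₁_eq_of_closed_on_box` (**relative Poincaré lemma in degree two**): if
  `d₂ ω (x; i, j, k) = 0` for every cube of the box (`x`, `x + eᵢ + eⱼ + e_k ∈ [a, b]`, `i < j < k`),
  then there is a link field `θ` with `d₁ θ (x; i, j) = ω (x; i, j)` for every plaquette of the
  box (`x`, `x + eᵢ + eⱼ ∈ [a, b]`, `i < j`), which moreover is in the COMB GAUGE based at the
  corner `a`: `θ (x; i) = 0` whenever `x_m = a_m` for all `m > i` (`boxPrim₂_comb`);
* `eq_zero_of_comb_of_d₁_eq_zero` (**uniqueness**): a comb-gauge link field whose plaquette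
  variables vanish on the box vanishes on the links of the box — so `ℓ ↦ dℓ` is a bijection from
  comb-gauge integer link fields of the box onto the plaquette fields closed on its cubes
  (`d₁_injective_of_comb`).

Everything is proved; no named fact is introduced.

## References

* J. Fröhlich, T. Spencer, Comm. Math. Phys. 83 (1982) 411–454, §2.3 Lemma 1, §2.4 (2.21)–(2.24)
  (closed integer plaquette fields and their potentials). [FrohlichSpencerCMP1982]
* M. P. Forsström, J. Lenells, F. Viklund, Ann. Inst. H. Poincaré Probab. Stat. 58 (2022), §2
  (Lemma 2.2, Poincaré lemmas on boxes). [ForsstromLenellsViklund2022]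
-/

noncomputable section

open Finset Function

namespace Literature.MathematicalPhysics.QuantumFieldTheory

namespace LatticeForm

open Literature.Probability.LatticeModels (Site)

variable {d : ℕ} {A : Type*} [AddCommGroup A]

/-! ### The recursive primitive -/

/-- **The recursive primitive of a plaquette field.** `boxPrim₂ ω a (k+1)`: on the lower axes
`i < k`, the stage-`k` primitive at the projected point `(x, x_k := a_k)` minus the column sum
`∑_{a_k ≤ t < x_k} ω((x, x_k := t); i, k)`; zero on the axis `k` itself (axial gauge) and above.
[folklore] -/
def boxPrim₂ (ω : Site d → Fin d → Fin d → A) (a : Site d) : ℕ → Site d → Fin d → A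
  | 0 => fun _ _ => 0
  | k + 1 => fun x i =>
    if h : k < d then
      (if i.val < k then
        boxPrim₂ ω a k (update x ⟨k, h⟩ (a ⟨k, h⟩)) i -
          axisPrim (fun y => ω y i ⟨k, h⟩) ⟨k, h⟩ (a ⟨k, h⟩) x
      else 0)
    else boxPrim₂ ω a k x i

/-- Components on or above the last integrated axis vanish. [folklore] -/
theorem boxPrim₂_eq_zero_of_le (ω : Site d → Fin d → Fin d → A) (a : Site d) :
    ∀ (k : ℕ), k ≤ d → ∀ (x : Site d) (i : Fin d), k ≤ i.val → boxPrim₂ ω a k x i = 0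
  | 0, _, _, _, _ => rfl
  | k + 1, hk, x, i, hi => by
    have hkd : k < d := by omega
    simp only [boxPrim₂, dif_pos hkd]
    rw [if_neg (by omega)]

/-- **The primitive is in the comb gauge based at `a`**: `θ(x; i) = 0` if `x_m = a_m` for all
`m > i`. [folklore] -/
theorem boxPrim₂_comb (ω : Site d → Fin d → Fin d → A) (a : Site d) :
    ∀ (k : ℕ), k ≤ d → ∀ (x : Site d) (i : Fin d), (∀ m : Fin d, i.val < m.val → x m = a m) →
      boxPrim₂ ω a k x i = 0
  | 0, _, _, _, _ => rfl
  | k + 1, hk, x, i, hx => by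
    have hkd : k < d := by omega
    simp only [boxPrim₂, dif_pos hkd]
    by_cases hik : i.val < k
    · rw [if_pos hik]
      have hxk : x ⟨k, hkd⟩ = a ⟨k, hkd⟩ := hx ⟨k, hkd⟩ hik
      rw [axisPrim_eq_zero_of_le _ _ _ (by rw [hxk]), sub_zero]
      have : update x ⟨k, hkd⟩ (a ⟨k, hkd⟩) = x := by rw [← hxk, update_eq_self]
      rw [this]
      exact boxPrim₂_comb ω a k hkd.le x i hx
    · rw [if_neg hik]

/-! ### The relative Poincaré lemma -/

/-- **Relative Poincaré lemma in degree two on a box.** If the plaquette field `ω` is closed on the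
cubes of the box `[a, b]` — `d₂ ω (x; i, j, k) = 0` whenever `x` and `x + eᵢ + eⱼ + e_k` lie in the
box and `i < j < k` — then `θ = boxPrim₂ ω a d` satisfies `d₁ θ (x; i, j) = ω (x; i, j)` for every
plaquette of the box (`x`, `x + eᵢ + eⱼ ∈ [a, b]`, `i < j`); and `θ` is in the comb gauge based at
`a` (`boxPrim₂_comb`). (Integer plaquette fields of the Villain model with prescribed flux through
the cubes differ by coboundaries of integer link fields.)
[cite: FrohlichSpencerCMP1982, §2.3 Lemma 1, §2.4 (2.21)–(2.24); ForsstromLenellsViklund2022 §2 Lemma 2.2] -/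
theorem exists_d₁_eq_of_closed_on_box (ω : Site d → Fin d → Fin d → A) (a b : Site d)
    (hcl : ∀ (x : Site d) (i j k : Fin d), i.val < j.val → j.val < k.val → x ∈ Set.Icc a b →
      x + e i + e j + e k ∈ Set.Icc a b → d₂ ω x i j k = 0) :
    ∀ (x : Site d) (i j : Fin d), i.val < j.val → x ∈ Set.Icc a b → x + e i + e j ∈ Set.Icc a b →
      d₁ (boxPrim₂ ω a d) x i j = ω x i j := by
  classical
  -- the invariant of the induction on the number `k` of integrated axes
  have key : ∀ k : ℕ, k ≤ d → ∀ (x : Site d), x ∈ Set.Icc a b →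
      (∀ m : Fin d, k ≤ m.val → x m = a m) →
      ∀ i j : Fin d, i.val < j.val → j.val < k → x + e i + e j ∈ Set.Icc a b →
        d₁ (boxPrim₂ ω a k) x i j = ω x i j := by
    intro k
    induction k with
    | zero => intro _ x _ _ i j _ hj; exact absurd hj (Nat.not_lt_zero _)
    | succ k ih =>
      intro hk x hx hreset i j hij hjk hxij
      have hkd : k < d := by omega
      set κ : Fin d := ⟨k, hkd⟩ with hκ
      have hiκ : i ≠ κ := fun h => by rw [h] at hij; simp [hκ] at hij; omega
      have hik : i.val < k := by omega
      have hres' : ∀ m : Fin d, k ≤ m.val → m ≠ κ → x m = a m := fun m hm hne =>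
        hreset m (by
          have : m.val ≠ k := fun h => hne (Fin.ext h)
          omega)
      -- box bookkeeping
      have hxκ := ((mem_Icc_iff_inBoxAway κ).1 hx).1
      have hπmem : update x κ (a κ) ∈ Set.Icc a b :=
        update_mem_Icc_of_mem hx κ ⟨le_rfl, hxκ.1.trans hxκ.2⟩
      have hπreset : ∀ m : Fin d, k ≤ m.val → update x κ (a κ) m = a m := by
        intro m hm
        by_cases hmκ : m = κ
        · subst hmκ; exact update_self ..
        · rw [update_of_ne hmκ]; exact hres' m hm hmκ
      -- the values of `θ = boxPrim₂ ω a (k+1)` at the four corners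
      have hθ : ∀ (y : Site d) (m : Fin d), m.val < k →
          boxPrim₂ ω a (k + 1) y m =
            boxPrim₂ ω a k (update y κ (a κ)) m - axisPrim (fun z => ω z m κ) κ (a κ) y := by
        intro y m hm
        rw [hκ]
        simp only [boxPrim₂, dif_pos hkd, if_pos hm]
      have hθκ : ∀ (y : Site d), boxPrim₂ ω a (k + 1) y κ = 0 := fun y => by
        rw [hκ]
        simp only [boxPrim₂, dif_pos hkd]
        rw [if_neg (lt_irrefl k)]
      rcases Nat.lt_or_ge j.val k with hjk' | hjk'
      · -- both axes already integrated: `i < j < k`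
        have hjκ : j ≠ κ := fun h => by rw [h] at hjk'; simp [hκ] at hjk'
        simp only [d₁]
        rw [hθ x i hik, hθ (x + e i) j hjk', hθ (x + e j) i hik, hθ x j hjk',
          update_add_single_of_ne x hiκ, update_add_single_of_ne x hjκ]
        -- the stage-`k` primitive on the floor
        have h1 : boxPrim₂ ω a k (update x κ (a κ)) i + boxPrim₂ ω a k (update x κ (a κ) + e i) j -
            boxPrim₂ ω a k (update x κ (a κ) + e j) i - boxPrim₂ ω a k (update x κ (a κ)) j =
            ω (update x κ (a κ)) i j := by
          have := ih hkd.le (update x κ (a κ)) hπmem hπreset i j hij hjk' (by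
            rw [← update_add_single_of_ne x hiκ, ← update_add_single_of_ne (x + e i) hjκ]
            refine update_mem_Icc_of_mem hxij κ ⟨le_rfl, ?_⟩
            have := ((mem_Icc_iff_inBoxAway κ).1 hxij).1.2
            rw [add_single_apply_of_ne _ (Ne.symm hjκ), add_single_apply_of_ne _ (Ne.symm hiκ)] at this
            exact hxκ.1.trans (by omega))
          simpa only [d₁] using this
        -- the column sums telescope by closedness on the cubes `(z_n; i, j, κ)`
        have h2 : axisPrim (fun z => ω z i κ) κ (a κ) x + axisPrim (fun z => ω z j κ) κ (a κ) (x + e i) -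
            axisPrim (fun z => ω z i κ) κ (a κ) (x + e j) - axisPrim (fun z => ω z j κ) κ (a κ) x =
            ω (update x κ (a κ)) i j - ω x i j := by
          simp only [axisPrim, add_single_apply_of_ne x (Ne.symm hiκ), add_single_apply_of_ne x (Ne.symm hjκ),
            axisSum_add_single_of_ne _ hiκ, axisSum_add_single_of_ne _ hjκ]
          simp only [axisSum, ← Finset.sum_add_distrib, ← Finset.sum_sub_distrib]
          have hstep : ∀ n ∈ Finset.range (x κ - a κ).toNat,
              ω (update x κ (a κ + n)) i κ + ω (update x κ (a κ + n) + e i) j κ -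
                  ω (update x κ (a κ + n) + e j) i κ - ω (update x κ (a κ + n)) j κ =
                ω (update x κ (a κ + n)) i j - ω (update x κ (a κ + (n + 1 : ℕ))) i j := by
            intro n hn
            have hn' : (n : ℤ) < (x κ - a κ).toNat := by exact_mod_cast Finset.mem_range.1 hn
            have hzmem : update x κ (a κ + n) ∈ Set.Icc a b :=
              update_mem_Icc_of_mem hx κ ⟨by omega, by omega⟩
            have hzmem' : update x κ (a κ + n) + e i + e j + e κ ∈ Set.Icc a b := by
              rw [add_right_comm _ (e j) (e κ), add_right_comm _ (e i) (e κ), update_add_single_eq,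
                ← update_add_single_of_ne x hiκ, ← update_add_single_of_ne (x + e i) hjκ]
              refine update_mem_Icc_of_mem hxij κ ⟨by omega, ?_⟩
              have := ((mem_Icc_iff_inBoxAway κ).1 hxij).1.2
              rw [add_single_apply_of_ne _ (Ne.symm hjκ), add_single_apply_of_ne _ (Ne.symm hiκ)] at this
              omega
            have hf := hcl _ i j κ hij (by simp [hκ]; exact hjk') hzmem hzmem'
            simp only [d₂] at hf
            rw [update_add_single_eq] at hf
            push_cast
            rw [← add_assoc]
            have : ω (update x κ (a κ + ↑n)) i κ + ω (update x κ (a κ + ↑n) + e i) j κ -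
                  ω (update x κ (a κ + ↑n) + e j) i κ - ω (update x κ (a κ + ↑n)) j κ -
                (ω (update x κ (a κ + ↑n)) i j - ω (update x κ (a κ + ↑n + 1)) i j) =
                ω (update x κ (a κ + ↑n) + e i) j κ - ω (update x κ (a κ + ↑n)) j κ -
                  (ω (update x κ (a κ + ↑n) + e j) i κ - ω (update x κ (a κ + ↑n)) i κ) +
                  (ω (update x κ (a κ + ↑n + 1)) i j - ω (update x κ (a κ + ↑n)) i j) := by abel
            exact sub_eq_zero.1 (this.trans hf)
          rw [Finset.sum_congr rfl hstep,
            Finset.sum_range_sub' (f := fun n : ℕ => ω (update x κ (a κ + n)) i j)]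
          have : a κ + (((x κ - a κ).toNat : ℕ) : ℤ) = x κ := by omega
          simp only [this, update_eq_self, Nat.cast_zero, add_zero]
        -- assemble
        have : boxPrim₂ ω a k (update x κ (a κ)) i - axisPrim (fun z => ω z i κ) κ (a κ) x +
            (boxPrim₂ ω a k (update x κ (a κ) + e i) j - axisPrim (fun z => ω z j κ) κ (a κ) (x + e i)) -
            (boxPrim₂ ω a k (update x κ (a κ) + e j) i - axisPrim (fun z => ω z i κ) κ (a κ) (x + e j)) -
            (boxPrim₂ ω a k (update x κ (a κ)) j - axisPrim (fun z => ω z j κ) κ (a κ) x) =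
            (boxPrim₂ ω a k (update x κ (a κ)) i + boxPrim₂ ω a k (update x κ (a κ) + e i) j -
              boxPrim₂ ω a k (update x κ (a κ) + e j) i - boxPrim₂ ω a k (update x κ (a κ)) j) -
            (axisPrim (fun z => ω z i κ) κ (a κ) x + axisPrim (fun z => ω z j κ) κ (a κ) (x + e i) -
              axisPrim (fun z => ω z i κ) κ (a κ) (x + e j) - axisPrim (fun z => ω z j κ) κ (a κ) x) := by
          abel
        rw [this, h1, h2]
        abel
      · -- the new axis: `j = κ`
        have hjκ : j = κ := Fin.ext (by simp [hκ]; omega)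
        subst hjκ
        simp only [d₁]
        rw [hθ x i hik, hθ (x + e κ) i hik, hθκ, hθκ, update_add_single_self]
        have h2 := axisPrim_add_single_sub_of_le (fun z => ω z i κ) κ (a κ) hxκ.1
        rw [← h2]
        abel
  intro x i j hij hx hxij
  exact key d le_rfl x hx (fun m hm => absurd m.2 (by omega)) i j hij j.2 hxij

/-! ### Uniqueness in the comb gauge -/

/-- **A comb-gauge link field with trivial plaquette variables on a box vanishes on the links of
the box**: if `θ (x; i) = 0` whenever `x_m = a_m` for all `m > i`, and `d₁ θ (x; i, j) = 0` for all
plaquettes of `[a, b]` with `i < j`, then `θ (x; i) = 0` for every link with `x`, `x + eᵢ ∈ [a, b]`.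
[folklore] -/
theorem eq_zero_of_comb_of_d₁_eq_zero (θ : Site d → Fin d → A) (a b : Site d)
    (hcomb : ∀ (x : Site d) (i : Fin d), (∀ m : Fin d, i.val < m.val → x m = a m) → θ x i = 0)
    (hflat : ∀ (x : Site d) (i j : Fin d), i.val < j.val → x ∈ Set.Icc a b →
      x + e i + e j ∈ Set.Icc a b → d₁ θ x i j = 0) :
    ∀ (x : Site d) (i : Fin d), x ∈ Set.Icc a b → x + e i ∈ Set.Icc a b → θ x i = 0 := by
  classical
  -- induction on the number `k` of free axes: points with `x_m = a_m` for `m ≥ k`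
  have key : ∀ k : ℕ, k ≤ d → ∀ (x : Site d), x ∈ Set.Icc a b →
      (∀ m : Fin d, k ≤ m.val → x m = a m) → ∀ i : Fin d, x + e i ∈ Set.Icc a b → θ x i = 0 := by
    intro k
    induction k with
    | zero =>
      intro _ x _ hreset i _
      exact hcomb x i fun m _ => hreset m (Nat.zero_le _)
    | succ k ih =>
      intro hk x hx hreset i hxi
      have hkd : k < d := by omega
      set κ : Fin d := ⟨k, hkd⟩ with hκ
      have hres' : ∀ m : Fin d, k ≤ m.val → m ≠ κ → x m = a m := fun m hm hne =>
        hreset m (by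
          have : m.val ≠ k := fun h => hne (Fin.ext h)
          omega)
      by_cases hiκ : κ.val ≤ i.val
      · -- `i ≥ κ`: comb gauge directly (all coordinates above `i` are frozen)
        exact hcomb x i fun m hm => hreset m (by simp [hκ] at hiκ; omega)
      · -- `i < κ`: descend along the axis `κ` using flatness of the plaquettes `(·; i, κ)`
        have hik : i.val < k := by simp [hκ] at hiκ; omega
        have hiκ' : i ≠ κ := fun h => by rw [h] at hik; simp [hκ] at hik
        have hxκ := ((mem_Icc_iff_inBoxAway κ).1 hx).1
        -- all points of the column have `θ (·; κ) = 0` (comb) and so `θ (·; i)` is constant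
        have hcol : ∀ n : ℕ, (n : ℤ) ≤ x κ - a κ → θ (update x κ (a κ + n)) i = θ (update x κ (a κ)) i := by
          intro n
          induction n with
          | zero => intro _; simp
          | succ n ihn =>
            intro hn
            rw [← ihn (by push_cast at hn ⊢; omega)]
            -- flatness on the plaquette `(z_n; i, κ)`
            have hzmem : update x κ (a κ + n) ∈ Set.Icc a b :=
              update_mem_Icc_of_mem hx κ ⟨by omega, by push_cast at hn; omega⟩
            have hzmem' : update x κ (a κ + n) + e i + e κ ∈ Set.Icc a b := by
              rw [add_right_comm, update_add_single_eq, ← update_add_single_of_ne x hiκ']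
              refine update_mem_Icc_of_mem hxi κ ⟨by omega, ?_⟩
              have := ((mem_Icc_iff_inBoxAway κ).1 hxi).1.2
              rw [add_single_apply_of_ne _ (Ne.symm hiκ')] at this
              push_cast at hn
              omega
            have hf := hflat _ i κ (by simp [hκ]; exact hik) hzmem hzmem'
            -- `θ (z; κ) = 0` and `θ (z + e i; κ) = 0` by the comb gauge (coordinates above `κ` frozen)
            have hc1 : θ (update x κ (a κ + n)) κ = 0 := hcomb _ κ fun m hm => by
              rw [update_of_ne (fun h => by rw [h] at hm; exact lt_irrefl _ hm)]
              exact hreset m (by simp [hκ] at hm; omega)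
            have hc2 : θ (update x κ (a κ + n) + e i) κ = 0 := hcomb _ κ fun m hm => by
              have hmκ : m ≠ κ := fun h => by rw [h] at hm; exact lt_irrefl _ hm
              have hmi : m ≠ i := fun h => by rw [h] at hm; simp [hκ] at hm; omega
              rw [add_single_apply_of_ne _ hmi, update_of_ne hmκ]
              exact hreset m (by simp [hκ] at hm; omega)
            simp only [d₁, hc1, hc2, add_zero, sub_zero, update_add_single_eq] at hf
            push_cast
            rw [← add_assoc]
            exact (sub_eq_zero.1 hf).symm
        have hn0 : ((x κ - a κ).toNat : ℤ) ≤ x κ - a κ := by omega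
        have h1 := hcol (x κ - a κ).toNat hn0
        have : a κ + (((x κ - a κ).toNat : ℕ) : ℤ) = x κ := by omega
        rw [this, update_eq_self] at h1
        rw [h1]
        -- the projected point is a stage-`k` point
        refine ih hkd.le (update x κ (a κ)) (update_mem_Icc_of_mem hx κ ⟨le_rfl, hxκ.1.trans hxκ.2⟩)
          (fun m hm => ?_) i ?_
        · by_cases hmκ : m = κ
          · subst hmκ; exact update_self ..
          · rw [update_of_ne hmκ]; exact hres' m hm hmκ
        · rw [← update_add_single_of_ne x hiκ']
          refine update_mem_Icc_of_mem hxi κ ⟨le_rfl, ?_⟩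
          have := ((mem_Icc_iff_inBoxAway κ).1 hxi).1
          exact this.1.trans this.2
  intro x i hx hxi
  exact key d le_rfl x hx (fun m hm => absurd m.2 (by omega)) i hxi

/-- **Injectivity of `ℓ ↦ dℓ` on comb-gauge link fields of a box**: two comb-gauge link fields
with the same plaquette variables on `[a, b]` agree on the links of `[a, b]`. [folklore] -/
theorem d₁_injective_of_comb (θ θ' : Site d → Fin d → A) (a b : Site d)
    (hcomb : ∀ (x : Site d) (i : Fin d), (∀ m : Fin d, i.val < m.val → x m = a m) → θ x i = 0)
    (hcomb' : ∀ (x : Site d) (i : Fin d), (∀ m : Fin d, i.val < m.val → x m = a m) → θ' x i = 0)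
    (heq : ∀ (x : Site d) (i j : Fin d), i.val < j.val → x ∈ Set.Icc a b →
      x + e i + e j ∈ Set.Icc a b → d₁ θ x i j = d₁ θ' x i j) :
    ∀ (x : Site d) (i : Fin d), x ∈ Set.Icc a b → x + e i ∈ Set.Icc a b → θ x i = θ' x i := by
  intro x i hx hxi
  have h := eq_zero_of_comb_of_d₁_eq_zero (θ - θ') a b
    (fun y m hm => by simp [hcomb y m hm, hcomb' y m hm])
    (fun y m m' hmm' hy hy' => by rw [d₁_sub, Pi.sub_apply, Pi.sub_apply, Pi.sub_apply, heq y m m' hmm' hy hy', sub_self])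
    x i hx hxi
  simpa [sub_eq_zero] using h

end LatticeForm

end Literature.MathematicalPhysics.QuantumFieldTheory
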